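import Mathlib
import Summits.NavierStokesRegularity.NavierStokesRegularity.Theorems.EulerZoomLiouvillePowerGaugeEulerLiouvilleFatCoreDefs
import Summits.NavierStokesRegularity.NavierStokesRegularity.Theorems.EulerZoomLiouvillePowerGaugeEulerLiouvilleEnergyTail
import Summits.NavierStokesRegularity.NavierStokesRegularity.Theorems.EulerZoomLiouvillePowerGaugeEulerLiouvilleNeedleThinCore
import HarnessLib

/-!
# E-TAIL's dust clause — plate t55-FAT: `RadialCapacity → FatCoreExclusion ρ` (`fatCorePlate : FatCorePlate`)

Sub-problem `NavierStokesRegularity`, crux `PowerGaugeEulerLiouville` (stmt-NavierStokesRegularity-19832; a crux CLASS of self-similar Euler/NS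
strata on the MODEL lattice — not NS regularity, not E).  Seat ns-ezl-w3 g7, plate t55-FAT (nsreg-p2 g42 ROUND-52 «PROVENANCE» §D, v1.3 R2;
`r52/Sketch52.lean` 99b21c971b35777c; defs BY NAME from `…FatCoreDefs`).

`fatCorePlate` — for `0 < ρ < 1`, the class-free radial capacity lemma (t55-RC, hypothesis `RadialCapacity`) turns the two profile-level shell
inputs of the tree (the A-gauge `∫_{B(0,R)}‖V‖² ≤ cR^{1−2ρ}` and the weighted-energy finiteness behind `Condenser.energyTail`) into
`¬HasFatFastCore ρ V`: a cofinal `b`-fat fast core at `‖y₀‖ = R` (`‖V‖ ≥ c₂R` on `B̄(y₀, c₁b)`, `b = R^{−(1+ρ)}`) would force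
`∫_{B(y₀,R/2)}‖DV‖² ≥ (π − v/L³)·c₁c₂²·R^{1−ρ}` with `v = vol{‖V‖ ≥ c₂R/2 in B(y₀,R/2)} ≤ 6c⁺/(c₂²R)` (Chebyshev against the A-gauge on
`B(0,3R/2)`), hence `≥ (π/2)c₁c₂²R^{1−ρ}` for large `R`, while `B(y₀,R/2) ⊂ shell(R/2) ∪ shell(R)` carries `≤ 2εR^{1−ρ}` by the E-TAIL —
absurd at `ε = πc₁c₂²/8`.
`Loc.selfSimilar_ae_eq_zero_of_fatFastCore_profile_of_radialCapacity` — the MEMBER modulo t55-RC: in the power-gauge class at `0 < ρ < 1`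
(binders of the E-TAIL members, `V ∈ C¹` suffices — no classical pressure is needed), `RadialCapacity →` a profile with a cofinal fat fast core
is trivial (`u = 0` a.e.): (E) and (A) are `NeedleThinCore.selfSimilar_needle_inputs` / `selfSimilar_shell_inputs`.  The unconditional member
is this ∘ `radialCapacity` (t55-RC, ns-sfl-p1 lane) — one line when it lands.
WHAT THIS IS NOT: not NS, not E — class-free measure bookkeeping about a hypothetical profile + a member of the MODEL-lattice crux class modulo
t55-RC; the wiring of «fat core» as a tameness alternative is the LEAD's; 19832 OPEN; NS regularity NOT proved.  [nsreg-p2 g42 ROUND-52 §D]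
-/

noncomputable section

open MeasureTheory Set Metric Real Function
open scoped InnerProductSpace RealInnerProductSpace ENNReal NNReal

set_option linter.dupNamespace false

namespace Summit.NavierStokesRegularity.NavierStokesRegularity.Theorems.PowerGaugeEulerLiouville

open Literature.Analysis Literature.Analysis.FluidPDE

/-- **PLATE t55-FAT** (`FatCorePlate`, text verbatim): for `0 < ρ < 1`, `RadialCapacity → FatCoreExclusion ρ` — the A-gauge and the E-TAIL
exclude a cofinal `b`-fat fast core. [nsreg-p2 g42 ROUND-52 §D v1.3] -/
theorem fatCorePlate : FatCorePlate := by
  intro ρ hρ hρ1 hRC V c hV hW hA hfat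
  obtain ⟨c₁, hc₁, c₂, hc₂, hcore⟩ := hfat
  have hVc : Continuous V := hV.continuous
  have hπ : 0 < Real.pi := Real.pi_pos
  -- WLOG the A-gauge constant is nonnegative
  obtain ⟨c', hc'0, hA'⟩ : ∃ c' : ℝ, 0 ≤ c' ∧ ∀ R : ℝ, 0 < R →
      ∫⁻ y in ball (0 : EuclideanSpace ℝ (Fin 3)) R, ‖V y‖ₑ ^ 2 ≤ ENNReal.ofReal (c' * R ^ (1 - 2 * ρ)) :=
    ⟨max c 0, le_max_right _ _, fun R hR => (hA R hR).trans
      (ENNReal.ofReal_le_ofReal (mul_le_mul_of_nonneg_right (le_max_left _ _) (Real.rpow_nonneg hR.le _)))⟩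
  -- the E-TAIL at `ε = πc₁c₂²/8`
  obtain ⟨R₁, hR₁⟩ := Condenser.energyTail ρ hρ1 V hV hW (Real.pi * c₁ * c₂ ^ 2 / 8) (by positivity)
  -- a far fat core
  obtain ⟨y₀, hy₀, hfat⟩ := hcore (max (max (2 * R₁) 2) (max (4 * c₁ + 1) (96 * c' / (Real.pi * c₂ ^ 2) + 1)))
  set R : ℝ := ‖y₀‖ with hRdef
  have hR2 : 2 ≤ R := le_trans (le_trans (le_max_right _ _) (le_max_left _ _)) hy₀
  have hR1 : 1 ≤ R := by linarith
  have hR0 : 0 < R := by linarith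
  have hRR₁ : R₁ ≤ R / 2 := by linarith [le_trans (le_trans (le_max_left _ _) (le_max_left _ _)) hy₀]
  have hRc₁ : 4 * c₁ + 1 ≤ R := le_trans (le_trans (le_max_left _ _) (le_max_right _ _)) hy₀
  have hRK : 96 * c' / (Real.pi * c₂ ^ 2) + 1 ≤ R := le_trans (le_trans (le_max_right _ _) (le_max_right _ _)) hy₀
  -- the scales `b = R^{−(1+ρ)} ≤ 1/R`, `m = c₂R`, `ℓ = c₁b`, `L = R/2`
  have hb : 0 < R ^ (-(1 + ρ)) := Real.rpow_pos_of_pos hR0 _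
  have hbR : R ^ (-(1 + ρ)) ≤ 1 / R := by
    have h1 : R ^ (-(1 + ρ)) ≤ R ^ (-(1 : ℝ)) := Real.rpow_le_rpow_of_exponent_le hR1 (by linarith)
    have h2 : R ^ (-(1 : ℝ)) = 1 / R := by rw [Real.rpow_neg hR0.le, Real.rpow_one, one_div]
    exact h1.trans h2.le
  have hRb : R ^ 2 * R ^ (-(1 + ρ)) = R ^ (1 - ρ) := by
    rw [← Real.rpow_two, ← Real.rpow_add hR0]
    congr 1
    ring
  have h2ℓ : 2 * (c₁ * R ^ (-(1 + ρ))) ≤ R / 2 := by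
    have h1 : 2 * (c₁ * R ^ (-(1 + ρ))) ≤ 2 * c₁ * (1 / R) := by nlinarith [hbR, hc₁]
    have h2 : 2 * c₁ * (1 / R) ≤ R / 2 := by
      rw [mul_one_div, div_le_div_iff₀ hR0 two_pos]
      nlinarith [hRc₁, hR1]
    exact h1.trans h2
  -- ### the radial capacity of the core
  have hcap := hRC V hV y₀ (c₂ * R) (c₁ * R ^ (-(1 + ρ))) (R / 2) (by positivity) (by positivity) h2ℓ hfat
  set S : Set (EuclideanSpace ℝ (Fin 3)) := {y ∈ ball y₀ (R / 2) | c₂ * R / 2 ≤ ‖V y‖} with hSdef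
  -- ### Chebyshev against the A-gauge: `v ≤ 6c'/(c₂²R)`
  have hSm : MeasurableSet S := by
    rw [hSdef]
    exact measurableSet_ball.inter (isClosed_le continuous_const hVc.norm).measurableSet
  have hSsub : S ⊆ ball y₀ (R / 2) := fun y hy => hy.1
  have hballsub : ball y₀ (R / 2) ⊆ ball (0 : EuclideanSpace ℝ (Fin 3)) (3 * R / 2) := fun y hy => by
    rw [mem_ball_zero_iff]
    rw [mem_ball, dist_eq_norm] at hy
    have h := norm_le_norm_add_norm_sub' y y₀
    have hsy : ‖y₀ - y‖ = ‖y - y₀‖ := norm_sub_rev _ _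
    linarith [hRdef]
  have hcheb : ENNReal.ofReal ((c₂ * R / 2) ^ 2) * volume S ≤ ENNReal.ofReal (c' * (3 * R / 2) ^ (1 - 2 * ρ)) := by
    calc ENNReal.ofReal ((c₂ * R / 2) ^ 2) * volume S
        = ∫⁻ _ in S, ENNReal.ofReal ((c₂ * R / 2) ^ 2) := (setLIntegral_const S _).symm
      _ ≤ ∫⁻ y in S, ‖V y‖ₑ ^ 2 := by
          refine setLIntegral_mono' hSm fun y hy => ?_
          rw [← ofReal_norm, ← ENNReal.ofReal_pow (norm_nonneg _)]
          exact ENNReal.ofReal_le_ofReal (pow_le_pow_left₀ (by positivity) hy.2 2)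
      _ ≤ ∫⁻ y in ball (0 : EuclideanSpace ℝ (Fin 3)) (3 * R / 2), ‖V y‖ₑ ^ 2 := lintegral_mono_set (hSsub.trans hballsub)
      _ ≤ ENNReal.ofReal (c' * (3 * R / 2) ^ (1 - 2 * ρ)) := hA' _ (by positivity)
  have hv : (c₂ * R / 2) ^ 2 * (volume S).toReal ≤ c' * (3 * R / 2) ^ (1 - 2 * ρ) := by
    have h := ENNReal.toReal_mono ENNReal.ofReal_ne_top hcheb
    rwa [ENNReal.toReal_mul, ENNReal.toReal_ofReal (by positivity), ENNReal.toReal_ofReal (by positivity)] at h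
  have h32 : (3 * R / 2) ^ (1 - 2 * ρ) ≤ 3 * R / 2 := by
    have h1 : (1 : ℝ) ≤ 3 * R / 2 := by linarith
    calc (3 * R / 2) ^ (1 - 2 * ρ) ≤ (3 * R / 2) ^ (1 : ℝ) := Real.rpow_le_rpow_of_exponent_le h1 (by linarith)
      _ = 3 * R / 2 := Real.rpow_one _
  have hv0 : 0 ≤ (volume S).toReal := ENNReal.toReal_nonneg
  have hv' : (volume S).toReal * (c₂ ^ 2 * R) ≤ 6 * c' := by
    have h := hv.trans (mul_le_mul_of_nonneg_left h32 hc'0)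
    -- `h : (c₂R/2)²·v ≤ c'·(3R/2)`, i.e. `R·(c₂²R·v) ≤ R·6c'`
    have h' : R * ((volume S).toReal * (c₂ ^ 2 * R)) ≤ R * (6 * c') := by nlinarith [h]
    exact le_of_mul_le_mul_left h' hR0
  have hF3 : (volume S).toReal / (R / 2) ^ 3 ≤ Real.pi / 2 := by
    rw [div_le_iff₀ (by positivity)]
    have hR4 : R ≤ R ^ 4 := le_self_pow₀ hR1 (by norm_num)
    have h96 : 96 * c' ≤ Real.pi * c₂ ^ 2 * R ^ 4 := by
      have h1 : 96 * c' / (Real.pi * c₂ ^ 2) ≤ R ^ 4 := by linarith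
      rw [div_le_iff₀ (by positivity)] at h1
      linarith
    -- `v·(c₂²R) ≤ 6c'` and `96c' ≤ πc₂²R⁴` give `16v ≤ πR³`
    have h2 : (c₂ ^ 2 * R) * ((volume S).toReal * 16) ≤ (c₂ ^ 2 * R) * (Real.pi * R ^ 3) := by
      linarith [hv', h96]
    have h3 : (volume S).toReal * 16 ≤ Real.pi * R ^ 3 := le_of_mul_le_mul_left h2 (by positivity)
    linarith [h3]
  -- ### the E-TAIL on `B(y₀, R/2) ⊂ shell(R/2) ∪ shell(R)`
  have hsub2 : ball y₀ (R / 2) ⊆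
      (closedBall (0 : EuclideanSpace ℝ (Fin 3)) (2 * (R / 2)) \ ball (0 : EuclideanSpace ℝ (Fin 3)) (R / 2)) ∪
        (closedBall (0 : EuclideanSpace ℝ (Fin 3)) (2 * R) \ ball (0 : EuclideanSpace ℝ (Fin 3)) R) := by
    intro y hy
    rw [mem_ball, dist_eq_norm] at hy
    have h1 := norm_le_norm_add_norm_sub' y y₀
    have h2 := norm_le_norm_add_norm_sub' y₀ y
    have hsy : ‖y₀ - y‖ = ‖y - y₀‖ := norm_sub_rev _ _
    by_cases hyR : ‖y‖ ≤ R
    · left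
      refine ⟨mem_closedBall_zero_iff.2 (by linarith), fun h => ?_⟩
      rw [mem_ball_zero_iff] at h
      linarith [hRdef]
    · right
      refine ⟨mem_closedBall_zero_iff.2 (by linarith [hRdef]), fun h => hyR (mem_ball_zero_iff.1 h).le⟩
  have hE1 := hR₁ (R / 2) hRR₁
  have hE2 := hR₁ R (by linarith)
  have hhalf : Real.pi * c₁ * c₂ ^ 2 / 8 * (R / 2) ^ (1 - ρ) ≤ Real.pi * c₁ * c₂ ^ 2 / 8 * R ^ (1 - ρ) :=
    mul_le_mul_of_nonneg_left (Real.rpow_le_rpow (by positivity) (by linarith) (by linarith)) (by positivity)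
  have hlin : ∫⁻ y in ball y₀ (R / 2), ‖fderiv ℝ V y‖ₑ ^ 2
      ≤ ENNReal.ofReal (2 * (Real.pi * c₁ * c₂ ^ 2 / 8) * R ^ (1 - ρ)) := by
    calc ∫⁻ y in ball y₀ (R / 2), ‖fderiv ℝ V y‖ₑ ^ 2
        ≤ ∫⁻ y in (closedBall (0 : EuclideanSpace ℝ (Fin 3)) (2 * (R / 2)) \ ball (0 : EuclideanSpace ℝ (Fin 3)) (R / 2)) ∪
            (closedBall (0 : EuclideanSpace ℝ (Fin 3)) (2 * R) \ ball (0 : EuclideanSpace ℝ (Fin 3)) R), ‖fderiv ℝ V y‖ₑ ^ 2 :=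
          lintegral_mono_set hsub2
      _ ≤ (∫⁻ y in closedBall (0 : EuclideanSpace ℝ (Fin 3)) (2 * (R / 2)) \ ball (0 : EuclideanSpace ℝ (Fin 3)) (R / 2),
              ‖fderiv ℝ V y‖ₑ ^ 2) +
            ∫⁻ y in closedBall (0 : EuclideanSpace ℝ (Fin 3)) (2 * R) \ ball (0 : EuclideanSpace ℝ (Fin 3)) R, ‖fderiv ℝ V y‖ₑ ^ 2 :=
          lintegral_union_le _ _ _
      _ ≤ ENNReal.ofReal (Real.pi * c₁ * c₂ ^ 2 / 8 * (R / 2) ^ (1 - ρ))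
            + ENNReal.ofReal (Real.pi * c₁ * c₂ ^ 2 / 8 * R ^ (1 - ρ)) := add_le_add hE1 hE2
      _ ≤ ENNReal.ofReal (Real.pi * c₁ * c₂ ^ 2 / 8 * R ^ (1 - ρ))
            + ENNReal.ofReal (Real.pi * c₁ * c₂ ^ 2 / 8 * R ^ (1 - ρ)) :=
          add_le_add (ENNReal.ofReal_le_ofReal hhalf) le_rfl
      _ = ENNReal.ofReal (2 * (Real.pi * c₁ * c₂ ^ 2 / 8) * R ^ (1 - ρ)) := by
          rw [← ENNReal.ofReal_add (by positivity) (by positivity)]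
          congr 1
          ring
  have hcn : Continuous fun y => ‖fderiv ℝ V y‖ ^ 2 := ((hV.continuous_fderiv one_ne_zero).norm).pow 2
  have hin : IntegrableOn (fun y => ‖fderiv ℝ V y‖ ^ 2) (ball y₀ (R / 2)) :=
    (hcn.continuousOn.integrableOn_compact (isCompact_closedBall y₀ (R / 2))).mono_set ball_subset_closedBall
  have hI : ∫ y in ball y₀ (R / 2), ‖fderiv ℝ V y‖ ^ 2 ≤ 2 * (Real.pi * c₁ * c₂ ^ 2 / 8) * R ^ (1 - ρ) := by
    rw [integral_eq_lintegral_of_nonneg_ae (Filter.Eventually.of_forall fun y => sq_nonneg _) hin.aestronglyMeasurable]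
    refine ENNReal.toReal_le_of_le_ofReal (by positivity) (le_trans (le_of_eq ?_) hlin)
    refine lintegral_congr fun y => ?_
    rw [← ofReal_norm, ENNReal.ofReal_pow (norm_nonneg _)]
  -- ### the contradiction `(π/2)c₁c₂²R^{1−ρ} ≤ (π/4)c₁c₂²R^{1−ρ}`
  have hD : Real.pi / 2 ≤ Real.pi - (volume S).toReal / (R / 2) ^ 3 := by linarith
  have hpos1 : 0 ≤ (c₂ * R) ^ 2 * (c₁ * R ^ (-(1 + ρ))) := by positivity
  have hF1 : (c₂ * R) ^ 2 * (c₁ * R ^ (-(1 + ρ))) * (Real.pi / 2) ≤ ∫ y in ball y₀ (R / 2), ‖fderiv ℝ V y‖ ^ 2 :=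
    (mul_le_mul_of_nonneg_left hD hpos1).trans hcap
  have hX : (c₂ * R) ^ 2 * (c₁ * R ^ (-(1 + ρ))) = c₁ * c₂ ^ 2 * R ^ (1 - ρ) := by
    rw [← hRb]; ring
  rw [hX] at hF1
  have hM : 0 < Real.pi * (c₁ * c₂ ^ 2 * R ^ (1 - ρ)) := by positivity
  have hchain := hF1.trans hI
  exact absurd hchain (by nlinarith [hM])

/-- **FAT-CORE MEMBER modulo t55-RC**: in the power-gauge class at `0 < ρ < 1` (suitable weak solution on `(−∞,0) × ℝ³` with weak gradient
and the three gauges, backward self-similar with a `C¹` profile `V`), `RadialCapacity` and a cofinal `b`-fat fast core (`HasFatFastCore ρ V`)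
force `u = 0` a.e. — (E) `selfSimilar_needle_inputs`, (A) `selfSimilar_shell_inputs`, `fatCorePlate`. [nsreg-p2 g42 ROUND-52 §D] -/
theorem Loc.selfSimilar_ae_eq_zero_of_fatFastCore_profile_of_radialCapacity (hRC : RadialCapacity) {ρ : ℝ} (hρ : 0 < ρ) (hρ1 : ρ < 1)
    {u : ℝ → EuclideanSpace ℝ (Fin 3) → EuclideanSpace ℝ (Fin 3)} {p : ℝ → EuclideanSpace ℝ (Fin 3) → ℝ}
    {H : ℝ → EuclideanSpace ℝ (Fin 3) → EuclideanSpace ℝ (Fin 3) →L[ℝ] EuclideanSpace ℝ (Fin 3)} {c : ℝ≥0}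
    (hsw : IsSuitableWeakSolutionOn (slab (EuclideanSpace ℝ (Fin 3)) (Iio 0) isOpen_Iio) 0 0 u p)
    (hH : HasWeakSpatialGradientOn (slab (EuclideanSpace ℝ (Fin 3)) (Iio 0) isOpen_Iio) u H)
    (hgauge : ∀ a : ℝ, 0 < a →
      ENNReal.ofReal (a ^ (2 * ρ)) * cknA a (0 : ℝ × EuclideanSpace ℝ (Fin 3)) u +
          ENNReal.ofReal (a ^ ρ) * cknE a (0 : ℝ × EuclideanSpace ℝ (Fin 3)) H +
        ENNReal.ofReal (a ^ (2 * ρ)) * cknD a (0 : ℝ × EuclideanSpace ℝ (Fin 3)) p ≤ (c : ℝ≥0∞))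
    {V : EuclideanSpace ℝ (Fin 3) → EuclideanSpace ℝ (Fin 3)} {P : EuclideanSpace ℝ (Fin 3) → ℝ}
    (hu : ∀ τ : ℝ, τ < 0 → u τ = selfSimilarCollapse (1 / (2 + ρ)) 0 V τ)
    (hp : ∀ τ : ℝ, τ < 0 → p τ = selfSimilarCollapsePressure (1 / (2 + ρ)) 0 P τ)
    (hV : ContDiff ℝ 1 V)
    (hQ : HasFatFastCore ρ V) :
    uncurry u =ᵐ[volume.restrict (Iio (0 : ℝ) ×ˢ (univ : Set (EuclideanSpace ℝ (Fin 3))))] 0 := by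
  obtain ⟨-, hE'⟩ := NeedleThinCore.selfSimilar_needle_inputs hρ hρ1 hsw hH hgauge hu hp hV
  have hEfin : (∫⁻ y, ‖fderiv ℝ V y‖ₑ ^ 2 * ENNReal.ofReal (‖y‖ ^ (ρ - 1))) ≠ ⊤ :=
    ne_top_of_le_ne_top ENNReal.ofReal_ne_top hE'
  have hA : ∀ R : ℝ, 0 < R →
      ∫⁻ y in ball (0 : EuclideanSpace ℝ (Fin 3)) R, ‖V y‖ₑ ^ 2 ≤ ENNReal.ofReal ((c : ℝ) * R ^ (1 - 2 * ρ)) :=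
    fun R hR => (NeedleThinCore.selfSimilar_shell_inputs hρ hρ1 hsw hH hgauge hu hp hV hR).2
  exact (fatCorePlate ρ hρ hρ1 hRC V c hV hEfin hA hQ).elim

end Summit.NavierStokesRegularity.NavierStokesRegularity.Theorems.PowerGaugeEulerLiouville

end
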